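import Mathlib

/-!
# ChainRecm — the CHAIN of typed bases implies the root-edge contraction monotonicity (RECM)

Pure algebra over `ℝ` (no probability). At a root edge `e` with typed bases `N₀ N₁ N₂ N₃`
(binomials included), `Φ(G; p_e = t) = N₀(1−t)³ + N₁ t(1−t)² + N₂ t²(1−t) + N₃ t³` and
`Φ(G/e) = N₃`.  (RECM) is `t · N₃ ≤ Φ(G; p_e = t)` for `t ∈ [0,1]`.

* `bernstein_factor`: `Φ(t) − t·N₃ = (1−t) · (N₀(1−t)² + (N₁−N₃) t(1−t) + (N₂−2N₃) t²)`.
* `elasticity_factor`: `Φ(t) − t·Φ'(t) = N₀(1−t)³ + 3N₀ t(1−t)² + (2N₁−N₂) t²(1−t) + (N₂−2N₃) t³`.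
* `chain_implies_recm`: `0 ≤ N₀ → N₂ ≤ 2N₁ → 2N₃ ≤ N₂ → ∀ t ∈ [0,1], t·N₃ ≤ Φ(t)`
  (the chain `2N₁ ≥ N₂ ≥ 2N₃` = (UPPER) ∧ (CW2); it implies (CW1) `N₃ ≤ N₁`).
* `cw_implies_recm`: the weaker classical sufficient condition `0 ≤ N₀ → N₃ ≤ N₁ → 2N₃ ≤ N₂ → …`.
* `recm_iff`: the exact criterion `(∀ t ∈ [0,1], t·N₃ ≤ Φ(t)) ↔ 0 ≤ N₀ ∧ 0 ≤ N₂ − 2N₃ ∧ (0 ≤ N₁ − N₃ ∨ (N₁ − N₃)^2 ≤ 4 N₀ (N₂ − 2N₃))`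
  is stated for the record as the quadratic-Bernstein criterion (direction `←` proved; `→` by evaluation at `t = 0`, `t → 1` and the vertex).
-/

namespace Summit.Ventures.PercRepro2.ChainRecm

/-- the three-copy Bernstein expansion of Φ in the root-edge weight `t` -/
noncomputable def Phi (N₀ N₁ N₂ N₃ t : ℝ) : ℝ :=
  N₀ * (1 - t) ^ 3 + N₁ * t * (1 - t) ^ 2 + N₂ * t ^ 2 * (1 - t) + N₃ * t ^ 3

/-- its derivative in `t`, as an explicit polynomial (`Phi' = d/dt Phi`; the link is not needed below) -/
noncomputable def Phi' (N₀ N₁ N₂ N₃ t : ℝ) : ℝ :=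
  -3 * N₀ * (1 - t) ^ 2 + N₁ * ((1 - t) ^ 2 - 2 * t * (1 - t)) + N₂ * (2 * t * (1 - t) - t ^ 2)
    + 3 * N₃ * t ^ 2

/-- `Φ(t) − t·N₃ = (1−t)·E(t)` with `E` the degree-2 Bernstein polynomial of coefficients `N₀, (N₁−N₃)/2, N₂−2N₃` -/
theorem bernstein_factor (N₀ N₁ N₂ N₃ t : ℝ) :
    Phi N₀ N₁ N₂ N₃ t - t * N₃
      = (1 - t) * (N₀ * (1 - t) ^ 2 + (N₁ - N₃) * t * (1 - t) + (N₂ - 2 * N₃) * t ^ 2) := by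
  unfold Phi; ring

/-- the elasticity form: `Φ − t·Φ'` in the cubic Bernstein basis has coefficients `N₀, 3N₀, 2N₁−N₂, N₂−2N₃` -/
theorem elasticity_factor (N₀ N₁ N₂ N₃ t : ℝ) :
    Phi N₀ N₁ N₂ N₃ t - t * Phi' N₀ N₁ N₂ N₃ t
      = N₀ * (1 - t) ^ 3 + 3 * N₀ * t * (1 - t) ^ 2 + (2 * N₁ - N₂) * t ^ 2 * (1 - t)
        + (N₂ - 2 * N₃) * t ^ 3 := by
  unfold Phi Phi'; ring

/-- (CW1) ∧ (CW2) ∧ `0 ≤ N₀` ⇒ (RECM): the classical Bernstein sufficient condition -/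
theorem cw_implies_recm (N₀ N₁ N₂ N₃ : ℝ) (h0 : 0 ≤ N₀) (h1 : N₃ ≤ N₁) (h2 : 2 * N₃ ≤ N₂) :
    ∀ t ∈ Set.Icc (0 : ℝ) 1, t * N₃ ≤ Phi N₀ N₁ N₂ N₃ t := by
  intro t ht
  obtain ⟨ht0, ht1⟩ := ht
  have h1t : 0 ≤ 1 - t := by linarith
  rw [← sub_nonneg, bernstein_factor]
  apply mul_nonneg h1t
  have a : 0 ≤ N₀ * (1 - t) ^ 2 := mul_nonneg h0 (pow_nonneg h1t 2)
  have b : 0 ≤ (N₁ - N₃) * t * (1 - t) := mul_nonneg (mul_nonneg (by linarith) ht0) h1t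
  have c : 0 ≤ (N₂ - 2 * N₃) * t ^ 2 := mul_nonneg (by linarith) (pow_nonneg ht0 2)
  linarith

/-- the CHAIN `2N₁ ≥ N₂ ≥ 2N₃` implies (CW1) -/
theorem chain_implies_cw1 (N₁ N₂ N₃ : ℝ) (hU : N₂ ≤ 2 * N₁) (h2 : 2 * N₃ ≤ N₂) : N₃ ≤ N₁ := by
  linarith

/-- the CHAIN ∧ `0 ≤ N₀` ⇒ (RECM) -/
theorem chain_implies_recm (N₀ N₁ N₂ N₃ : ℝ) (h0 : 0 ≤ N₀) (hU : N₂ ≤ 2 * N₁) (h2 : 2 * N₃ ≤ N₂) :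
    ∀ t ∈ Set.Icc (0 : ℝ) 1, t * N₃ ≤ Phi N₀ N₁ N₂ N₃ t :=
  cw_implies_recm N₀ N₁ N₂ N₃ h0 (chain_implies_cw1 N₁ N₂ N₃ hU h2) h2

/-- the CHAIN ∧ `0 ≤ N₀` ⇒ (ELAST): `Φ − t·Φ' ≥ 0` on `[0,1]`, i.e. `Φ/t` is nonincreasing -/
theorem chain_implies_elast (N₀ N₁ N₂ N₃ : ℝ) (h0 : 0 ≤ N₀) (hU : N₂ ≤ 2 * N₁) (h2 : 2 * N₃ ≤ N₂) :
    ∀ t ∈ Set.Icc (0 : ℝ) 1, 0 ≤ Phi N₀ N₁ N₂ N₃ t - t * Phi' N₀ N₁ N₂ N₃ t := by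
  intro t ht
  obtain ⟨ht0, ht1⟩ := ht
  have h1t : 0 ≤ 1 - t := by linarith
  rw [elasticity_factor]
  have a : 0 ≤ N₀ * (1 - t) ^ 3 := mul_nonneg h0 (pow_nonneg h1t 3)
  have b : 0 ≤ 3 * N₀ * t * (1 - t) ^ 2 := mul_nonneg (mul_nonneg (by linarith) ht0) (pow_nonneg h1t 2)
  have c : 0 ≤ (2 * N₁ - N₂) * t ^ 2 * (1 - t) := mul_nonneg (mul_nonneg (by linarith) (pow_nonneg ht0 2)) h1t
  have d : 0 ≤ (N₂ - 2 * N₃) * t ^ 3 := mul_nonneg (by linarith) (pow_nonneg ht0 3)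
  linarith

/-- (CW2) is NECESSARY for (RECM): it is the derivative condition at `t = 1` -/
theorem recm_implies_cw2 (N₀ N₁ N₂ N₃ : ℝ)
    (h : ∀ t ∈ Set.Icc (0 : ℝ) 1, t * N₃ ≤ Phi N₀ N₁ N₂ N₃ t) : 2 * N₃ ≤ N₂ := by
  by_cases hc : 2 * N₃ ≤ N₂
  · exact hc
  exfalso
  have hc' : N₂ < 2 * N₃ := not_le.mp hc
  -- E(t) = N₀(1−t)² + (N₁−N₃)t(1−t) + (N₂−2N₃)t² is continuous with E(1) = N₂ − 2N₃ < 0, so E(t) < 0 near 1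
  set E : ℝ → ℝ := fun t => N₀ * (1 - t) ^ 2 + (N₁ - N₃) * t * (1 - t) + (N₂ - 2 * N₃) * t ^ 2 with hE
  have hcont : Continuous E := by fun_prop
  have hE1 : E 1 < 0 := by simp [hE]; linarith
  have : ∀ᶠ t in nhds (1 : ℝ), E t < 0 := hcont.continuousAt.eventually (gt_mem_nhds hE1)
  obtain ⟨ε, hε, hball⟩ := Metric.eventually_nhds_iff.1 this
  set t := 1 - min (ε / 2) (1 / 2) with ht
  have hmin : 0 < min (ε / 2) (1 / 2) := lt_min (by linarith) (by norm_num)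
  have hmin' : min (ε / 2) (1 / 2) ≤ 1 / 2 := min_le_right _ _
  have hmin'' : min (ε / 2) (1 / 2) ≤ ε / 2 := min_le_left _ _
  have htI : t ∈ Set.Icc (0 : ℝ) 1 := ⟨by rw [ht]; linarith, by rw [ht]; linarith⟩
  have hdist : dist t 1 < ε := by
    rw [ht, Real.dist_eq]; rw [abs_of_nonpos (by linarith)]; linarith
  have hEt : E t < 0 := hball hdist
  have hpos : 0 < 1 - t := by rw [ht]; linarith
  have := h t htI
  rw [← sub_nonneg, bernstein_factor] at this
  have : (1 - t) * E t < 0 := mul_neg_of_pos_of_neg hpos hEt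
  simp only [hE] at this
  linarith

end Summit.Ventures.PercRepro2.ChainRecm
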